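import Summits.NavierStokesRegularity.NavierStokesRegularity.Theorems.RellichScarSymmetricScarExistsScarDefectLimit
import Summits.NavierStokesRegularity.NavierStokesRegularity.Theorems.RellichScarSymmetricScarExistsApexScarTrace
import Summits.NavierStokesRegularity.NavierStokesRegularity.Theorems.RellichScarSymmetricScarExistsRotWindowRigidity
import Summits.NavierStokesRegularity.NavierStokesRegularity.Theorems.RellichScarSymmetricScarExistsRdssCalibrations
import Summits.NavierStokesRegularity.NavierStokesRegularity.Theorems.RellichScarSymmetricScarExistsIrrationalStabiliser
import Literature.Analysis.FluidPDE.KNSSTypeIRateLimit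

/-!
# Crux `SymmetricScarExists` (stmt-NavierStokesRegularity-11718), line `rdss-screw-split` —
# stub `stub_irrationalScarRotation` (AUX-6): a scar fixed by one irrational rotation is axisymmetric

Helper file of the line lead (`--supports stmt-NavierStokesRegularity-11718`; theorems only).
SCAR LEVEL.  Let `u` be an apex Type-I profile (suitable weak solution on the backward slab
`t < 0` with `𝐈 < ∞` and the apex bound `‖u‖ ≤ C/(‖x‖ + √−t)`).  If ONE rotation-conjugate
`conjZ θ u = R_θ u(t, R_{−θ}·)` with `θ/2π ∉ ℚ` has the same scar as `u` (`SameScar (conjZ θ u) u`),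
then every rotation-conjugate has (`AxiScar u`).

Proof.  The stabiliser `S = {φ | SameScar (conjZ φ u) u}` is an additive subgroup of `ℝ`
(`sameScar_conjZ_zero/add/neg`) containing `2π` (`conjZ (2π) u = u`) and `θ`.  NEW here: `S` is
CLOSED.  Pass to the classical (mild) representative `V` of `u`
(`RellichScarScarRigidity.stub_apexMildRepresentative`; `SameScar` only sees the slab up to null
sets, `sameScar_congr_ae`, `conjZ_ae_eq_slab`) and its scar `σ` with the cubic rate
`‖V(t,x) − σ(x)‖ ≤ L(−t)/‖x‖³`, `σ` locally Lipschitz off the origin (`stub_apexScarTrace`).  Along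
`θ_j → θ∞` in `S` the defects `conjZ θ_j V − V` are continuous on the open slab with static traces
`R_{θ_j} σ(R_{−θ_j}x) − σ(x)` (rate `2L`) converging pointwise to `R_{θ∞} σ(R_{−θ∞}x) − σ(x)`;
flatness of the defects (`SameScar (conjZ θ_j V) V`) forces the limit trace to vanish off the
origin (`static_limit_eq_zero_of_flat`: esssup = sup on open boxes, `t ↑ 0`, `j → ∞`), whence
`‖conjZ θ∞ V − V‖ ≤ 2L(−t)/‖x‖³` and `SameScar (conjZ θ∞ V) V` (`tendsto_eLpNorm_top_of_rate`).
Finally a closed subgroup of `ℝ` containing `2π` and an angle incommensurable with `2π` is `ℝ`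
(`NearIdentity.forall_of_irrational_angle_stabiliser`: dense-or-cyclic).

## References

* G. Koch, N. Nadirashvili, G. Seregin, V. Šverák, Acta Math. 203 (2009), §1 (1.6) and Prop. 4.1
  (rotation invariance, classical representatives). [folklore]
* N. Bourbaki, *General Topology*, Ch. V §1 no. 1 Prop. 1 (closed subgroups of `ℝ`). [folklore]
-/

noncomputable section

open MeasureTheory Set Function Filter Topology TopologicalSpace Metric
open scoped NNReal ENNReal

namespace Summit.NavierStokesRegularity.NavierStokesRegularity.Theorems.SymmetricScarExists.RdssSplit.ScarLevel

set_option linter.dupNamespace false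

open Literature.Analysis.FluidPDE
open Summit.NavierStokesRegularity.NavierStokesRegularity.Theses.RellichScar
open Summit.NavierStokesRegularity.NavierStokesRegularity.Theorems.SymmetricScarExists.Negative
open Summit.NavierStokesRegularity.NavierStokesRegularity.Theorems.SymmetricScarExists.ScarWindow

/-! ## The scar is continuous off the origin -/

/-- A static field with the local Lipschitz bound `‖σ(y) − σ(x)‖ ≤ (L/‖x‖²)·dist(y,x)` on
`closedBall x (‖x‖/2)` (`x ≠ 0`) is continuous off the origin. [folklore] -/
theorem irrScarRot_continuousAt_scar {σ : EuclideanSpace ℝ (Fin 3) → EuclideanSpace ℝ (Fin 3)}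
    {L : ℝ}
    (hlip : ∀ x y : EuclideanSpace ℝ (Fin 3), x ≠ 0 → dist y x ≤ ‖x‖ / 2 →
      ‖σ y - σ x‖ ≤ L / ‖x‖ ^ 2 * dist y x)
    {x : EuclideanSpace ℝ (Fin 3)} (hx : x ≠ 0) : ContinuousAt σ x := by
  have hxpos : 0 < ‖x‖ := norm_pos_iff.2 hx
  rw [ContinuousAt, tendsto_iff_norm_sub_tendsto_zero]
  refine squeeze_zero' (g := fun y => L / ‖x‖ ^ 2 * dist y x)
    (Eventually.of_forall fun y => norm_nonneg _) ?_ ?_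
  · filter_upwards [closedBall_mem_nhds x (half_pos hxpos)] with y hy
    exact hlip x y hx (mem_closedBall.1 hy)
  · have h : Tendsto (fun y : EuclideanSpace ℝ (Fin 3) => L / ‖x‖ ^ 2 * dist y x) (𝓝 x)
        (𝓝 (L / ‖x‖ ^ 2 * dist x x)) :=
      ((continuous_const.mul (continuous_id.dist continuous_const)).tendsto x)
    rwa [dist_self, mul_zero] at h

/-! ## The stabiliser of the scar under rotations is closed -/

/-- **Closed stabiliser, classical form.**  Let `V` be continuous on the open slab `t < 0` with a
static trace `σ` at the cubic rate `‖V(t,x) − σ(x)‖ ≤ L(−t)/‖x‖³` (`L ≥ 0`), `σ` continuous off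
the origin.  Then `{φ | SameScar (conjZ φ V) V}` is closed: along `θ_j → θ∞` in the set, the
defects `conjZ θ_j V − V` (continuous on the slab, traces `R_{θ_j}σ(R_{−θ_j}·) − σ` at rate `2L`,
converging pointwise off the origin) are flat, so the limit trace vanishes off the origin
(`static_limit_eq_zero_of_flat`), and the cubic rate of `conjZ θ∞ V − V` gives
`SameScar (conjZ θ∞ V) V` (`tendsto_eLpNorm_top_of_rate`). [folklore] -/
theorem irrScarRot_isClosed_stabiliser_of_rate
    {V : ℝ → EuclideanSpace ℝ (Fin 3) → EuclideanSpace ℝ (Fin 3)}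
    {σ : EuclideanSpace ℝ (Fin 3) → EuclideanSpace ℝ (Fin 3)} {L : ℝ} (hL : 0 ≤ L)
    (hcont : ContinuousOn (uncurry V) (Iio (0 : ℝ) ×ˢ (univ : Set (EuclideanSpace ℝ (Fin 3)))))
    (hrate : ∀ t < (0 : ℝ), ∀ x : EuclideanSpace ℝ (Fin 3), x ≠ 0 →
      ‖V t x - σ x‖ ≤ L * (-t) / ‖x‖ ^ 3)
    (hσ : ∀ x : EuclideanSpace ℝ (Fin 3), x ≠ 0 → ContinuousAt σ x) :
    IsClosed {φ : ℝ | SameScar (conjZ φ V) V} := by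
  refine IsSeqClosed.isClosed fun θs θl hθs hlim => ?_
  -- Step 1: the limit static defect vanishes off the origin
  have hfix : ∀ x : EuclideanSpace ℝ (Fin 3), x ≠ 0 → rotZ θl (σ (rotZ (-θl) x)) - σ x = 0 := by
    intro x hx
    refine static_limit_eq_zero_of_flat (F := fun j => uncurry (conjZ (θs j) V) - uncurry V)
      (τ := fun j y => rotZ (θs j) (σ (rotZ (-θs j) y)) - σ y)
      (τl := fun y => rotZ θl (σ (rotZ (-θl) y)) - σ y) (M := L + L)
      (fun j => (continuousOn_uncurry_conjZ (θs j) hcont).sub hcont) ?_ ?_ ?_ hx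
    · intro j t ht y hy
      have h1 := rate_conjZ (θs j) hrate t ht y hy
      have h2 := hrate t ht y hy
      calc ‖(uncurry (conjZ (θs j) V) - uncurry V) (t, y) - (rotZ (θs j) (σ (rotZ (-θs j) y)) - σ y)‖
          = ‖(conjZ (θs j) V t y - rotZ (θs j) (σ (rotZ (-θs j) y))) - (V t y - σ y)‖ := by
            congr 1
            show (conjZ (θs j) V t y - V t y) - _ = _
            abel
        _ ≤ ‖conjZ (θs j) V t y - rotZ (θs j) (σ (rotZ (-θs j) y))‖ + ‖V t y - σ y‖ :=
            norm_sub_le _ _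
        _ ≤ L * (-t) / ‖y‖ ^ 3 + L * (-t) / ‖y‖ ^ 3 := add_le_add h1 h2
        _ = (L + L) * (-t) / ‖y‖ ^ 3 := by ring
    · -- the static defects converge pointwise off the origin (`σ` is continuous there)
      intro y hy
      have hc : Continuous fun φ : ℝ => rotZ (-φ) y :=
        continuous_rotZ_uncurry.comp (f := fun φ : ℝ => (-φ, y))
          (continuous_neg.prodMk continuous_const)
      have hneg : Tendsto (fun j => rotZ (-θs j) y) atTop (𝓝 (rotZ (-θl) y)) :=
        (hc.tendsto θl).comp hlim
      have hσy : Tendsto (fun j => σ (rotZ (-θs j) y)) atTop (𝓝 (σ (rotZ (-θl) y))) :=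
        (hσ _ (rotZ_ne_zero (-θl) hy)).tendsto.comp hneg
      have hrot : Tendsto (fun j => rotZ (θs j) (σ (rotZ (-θs j) y))) atTop
          (𝓝 (rotZ θl (σ (rotZ (-θl) y)))) :=
        (continuous_rotZ_uncurry.tendsto (θl, σ (rotZ (-θl) y))).comp
          (f := fun j => (θs j, σ (rotZ (-θs j) y))) (hlim.prodMk_nhds hσy)
      exact hrot.sub tendsto_const_nhds
    · -- the defects are flat: `SameScar (conjZ (θs j) V) V` for every `j`
      intro K hK h0 ε hε
      refine Eventually.of_forall fun j => ?_
      have hj : SameScar (conjZ (θs j) V) V := hθs j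
      exact (ENNReal.tendsto_nhds_zero.1 (hj K hK h0)) (ENNReal.ofReal ε) (ENNReal.ofReal_pos.2 hε)
  -- Step 2: the defect of the limit angle has the cubic rate, hence a zero scar functional
  show SameScar (conjZ θl V) V
  intro K hK h0
  refine tendsto_eLpNorm_top_of_rate (D := uncurry (conjZ θl V) - uncurry V) (M := L + L)
    (by positivity) ?_ hK h0
  intro t ht x hx
  have h1 := rate_conjZ θl hrate t ht x hx
  have h2 := hrate t ht x hx
  have h3 : rotZ θl (σ (rotZ (-θl) x)) = σ x := sub_eq_zero.1 (hfix x hx)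
  calc ‖(uncurry (conjZ θl V) - uncurry V) (t, x)‖
      = ‖(conjZ θl V t x - rotZ θl (σ (rotZ (-θl) x))) - (V t x - σ x)‖ := by
        congr 1
        show conjZ θl V t x - V t x = _
        rw [h3]
        abel
    _ ≤ ‖conjZ θl V t x - rotZ θl (σ (rotZ (-θl) x))‖ + ‖V t x - σ x‖ := norm_sub_le _ _
    _ ≤ L * (-t) / ‖x‖ ^ 3 + L * (-t) / ‖x‖ ^ 3 := add_le_add h1 h2
    _ = (L + L) * (-t) / ‖x‖ ^ 3 := by ring

/-- **Closed stabiliser, apex form.**  For an apex Type-I profile `u` (suitable weak solution on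
the backward slab, `𝐈 < ∞`, apex bound of constant `C > 0`) the stabiliser
`{φ | SameScar (conjZ φ u) u}` is closed: replace `u` by its classical representative
(`stub_apexMildRepresentative`; `sameScar_congr_ae`, `conjZ_ae_eq_slab`), which has a scar with
the cubic rate and local Lipschitz bound (`stub_apexScarTrace`), and apply
`irrScarRot_isClosed_stabiliser_of_rate`. [folklore] -/
theorem irrScarRot_isClosed_stabiliser_apex
    (u : ℝ → EuclideanSpace ℝ (Fin 3) → EuclideanSpace ℝ (Fin 3))
    (p : ℝ → EuclideanSpace ℝ (Fin 3) → ℝ)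
    (G : ℝ → EuclideanSpace ℝ (Fin 3) → EuclideanSpace ℝ (Fin 3) →L[ℝ] EuclideanSpace ℝ (Fin 3))
    {C : ℝ} (hC : 0 < C)
    (hsw : IsSuitableWeakSolutionOn (slab (EuclideanSpace ℝ (Fin 3)) (Iio (0 : ℝ)) isOpen_Iio) 1 0 u p)
    (hwg : HasWeakSpatialGradientOn (slab (EuclideanSpace ℝ (Fin 3)) (Iio (0 : ℝ)) isOpen_Iio) u G)
    (hI : typeIBound (Iio (0 : ℝ) ×ˢ univ) u p G < ⊤) (hdec : HasTypeIDecay C u) :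
    IsClosed {φ : ℝ | SameScar (conjZ φ u) u} := by
  obtain ⟨V, hae, hmild, hdecV⟩ :=
    RellichScarScarRigidity.stub_apexMildRepresentative u p G C hC hsw hwg hI hdec
  obtain ⟨L, hL, hB1⟩ := stub_apexScarTrace C hC
  obtain ⟨σ, hrate, -, hlip⟩ := hB1 V hmild hdecV
  have hset : {φ : ℝ | SameScar (conjZ φ u) u} = {φ : ℝ | SameScar (conjZ φ V) V} := by
    ext φ
    exact (sameScar_congr_ae (conjZ_ae_eq_slab φ hae) hae).symm
  rw [hset]
  exact irrScarRot_isClosed_stabiliser_of_rate hL hmild.continuousOn_uncurry hrate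
    fun x hx => irrScarRot_continuousAt_scar hlip hx

/-! ## The registered stub -/

/-- **AUX-6 `stub_irrationalScarRotation`** (line `rdss-screw-split` of crux
stmt-NavierStokesRegularity-11718), SCAR LEVEL: if the scar of an apex Type-I profile `u` is
fixed by ONE rotation `R_θ` with `θ/2π` irrational (`SameScar (conjZ θ u) u`), it is fixed by
every rotation about the axis (`AxiScar u`).  The stabiliser `{φ | SameScar (conjZ φ u) u}` is an
additive subgroup of `ℝ` (`sameScar_conjZ_zero/add/neg`) containing `2π`
(`conjZ_two_pi_mul_int`) and `θ`, and it is closed (`irrScarRot_isClosed_stabiliser_apex`: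
classical representative, scar with cubic rate, flat defects pass to limits of angles); a closed
subgroup of `ℝ` containing `2π` and an angle incommensurable with `2π` is all of `ℝ`
(`NearIdentity.forall_of_irrational_angle_stabiliser`). [folklore] -/
theorem stub_irrationalScarRotation : ∀ (u : ℝ → EuclideanSpace ℝ (Fin 3) → EuclideanSpace ℝ (Fin 3)) (p : ℝ → EuclideanSpace ℝ (Fin 3) → ℝ) (G : ℝ → EuclideanSpace ℝ (Fin 3) → EuclideanSpace ℝ (Fin 3) →L[ℝ] EuclideanSpace ℝ (Fin 3)) (C θ : ℝ), 0 < C → Literature.Analysis.FluidPDE.IsSuitableWeakSolutionOn (Literature.Analysis.FluidPDE.slab (EuclideanSpace ℝ (Fin 3)) (Set.Iio 0) isOpen_Iio) 1 0 u p → Literature.Analysis.FluidPDE.HasWeakSpatialGradientOn (Literature.Analysis.FluidPDE.slab (EuclideanSpace ℝ (Fin 3)) (Set.Iio 0) isOpen_Iio) u G → Literature.Analysis.FluidPDE.typeIBound (Set.Iio (0 : ℝ) ×ˢ Set.univ) u p G < ⊤ → Literature.Analysis.FluidPDE.HasTypeIDecay C u → Irrational (θ / (2 * Real.pi)) → (∀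 K : Set (EuclideanSpace ℝ (Fin 3)), IsCompact K → (0 : EuclideanSpace ℝ (Fin 3)) ∉ K → Filter.Tendsto (fun δ : ℝ => MeasureTheory.eLpNorm (Function.uncurry (fun t x => Literature.Analysis.FluidPDE.rotZ θ (u t (Literature.Analysis.FluidPDE.rotZ (-θ) x))) - Function.uncurry u) ⊤ (MeasureTheory.volume.restrict (Set.Ioo (-δ) 0 ×ˢ K))) (nhdsWithin 0 (Set.Ioi 0)) (nhds 0)) → ∀ φ : ℝ, ∀ K : Set (EuclideanSpace ℝ (Fin 3)), IsCompact K → (0 : EuclideanSpace ℝ (Fin 3)) ∉ K → Filter.Tendsto (fun δ : ℝ => MeasureTheory.eLpNorm (Function.uncurry (fun t x => Literature.Analysis.FluidPDE.rotZ φ (u t (Literature.Analysis.FluidPDE.rotZ (-φ) x))) - Function.uncurry u) ⊤ (MeasureTheory.volume.restrict (Set.Ioo (-δ) 0 ×ˢ K))) (nhdsWithin 0 (Set.Ioi 0)) (nhds 0) := by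
  intro u p G C θ hC hsw hwg hI hdec hirr hθ
  change SameScar (conjZ θ u) u at hθ
  show ∀ φ : ℝ, SameScar (conjZ φ u) u
  have h2π : SameScar (conjZ (2 * Real.pi) u) u := by
    have e : conjZ (2 * Real.pi) u = u := by
      simpa using Calibration.conjZ_two_pi_mul_int 1 u
    rw [e]
    exact sameScar_refl u
  exact NearIdentity.forall_of_irrational_angle_stabiliser (P := fun φ => SameScar (conjZ φ u) u)
    (sameScar_conjZ_zero u) (fun _ _ h1 h2 => sameScar_conjZ_add h1 h2)
    (fun _ h => sameScar_conjZ_neg h)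
    (irrScarRot_isClosed_stabiliser_apex u p G hC hsw hwg hI hdec) hθ h2π hirr

end Summit.NavierStokesRegularity.NavierStokesRegularity.Theorems.SymmetricScarExists.RdssSplit.ScarLevel

end
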